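import Literature.MathematicalPhysics.QuantumFieldTheory.Balaban1983to89.B15DeterminingSets

/-!
# `Balaban1983to89.B15DeterminingSetsB` — the determining-set calculus of [Balaban1988Convergent] (= [III]) (2.10)–(2.12) and the splice
# (1.20) of [Balaban1989LargeFieldI] over a BOND-LEVEL determining datum `𝔅 = {𝔅_j ⊂ bonds of T^{(j)}}_j`, with the site-level calculus of
# `B15DeterminingSets` (`AgreeOn` :180, `spliceAt` :201, `IsMinimizer` :222, `DetBackground` :230) recovered DEFINITIONALLY at the instance
# `bondsDet 𝔹 := fun j => bondsOf (𝔹 j)` (reading (b): the bonds MEETING `Γ_j`), and PRINT's datum — [Balaban1984PropagatorsII] (2.3) p. 224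
# «Λ_j = Ω_j^{(j)} ∖ Ω_{j+1}^{(j)} … for the sets of sites and the sets of bonds», the DIFFERENCE of the bond sets — as the second instance
# `lamBondsSeq Ω k`

statement-level skeleton of published theorems with citation tags; proofs where landed; nothing here is a claim about the
Yang–Mills mass gap

WHY THIS FILE (cell `pub-ymgap`; (E1) variant (iii-b), work plan WORKPLAN-IIIB 27c850bec22d4efe, Stage 0 module F0a; director-ym №338 = GO on the
additive stages, №339 = ruling (α) on the bond-set reading; FLAG №16 ∕ LOCATE-HSEAM 5d3298b8d191f169; census E1-IMPACT-CENSUS 53a7b53fbfeb733d § (i)).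
HONESTY GUARD (№338 (5)): this module is the print-datum twin of `B15DeterminingSets` §Fields; the (b)-instance `B15DeterminingSets` stays landed
and true on its own text; NOTHING in it is edited; every declaration below is NEW, and each old predicate IS the new one at `bondsDet 𝔹` by `rfl` ∕
`Iff.rfl` (`agreeOnB_bondsDet`, `agreeOn_iff_agreeOnB`, `isMinimizer_iff_isMinimizerB`, `spliceAt_eq_spliceAtB`).  No displayed premise of any
consumer is deleted or weakened here (this file has no consumers' premises in it at all).

WHAT.  §1 `BDetSet` (one bond set per scale), `bondsDet` (the (b)-instance of a site-level `DetSet`), `AgreeOnB` = (2.10) over `𝔅`, with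
`agreeOnB_bondsDet : AgreeOnB (bondsDet 𝔹) = AgreeOn 𝔹` (`rfl`), antitonicity in `𝔅`, refl∕symm∕trans.  §2 `spliceAtB` = the splice (1.20) along a
bond set, `spliceAt_eq_spliceAtB`.  §3 `IsMinimizerB` ∕ `DetBackgroundB` = (2.12) over `𝔅`, `isMinimizer_iff_isMinimizerB` (`Iff.rfl`), and the
pull-back `DetBackgroundB.toDetBackground` of a bond-level solution map to the site-level one along `bondsDet`.  §4 PRINT's DATUM
`lamBondsSeq Ω k : BDetSet P` — at level `j` the bonds meeting `Γ_j^{(j)}` (`bondsOf (genSet Ω k j)`) none of whose two end-points has its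
`(j+1)`-block among the `(j+1)`-points of `Ω_{j+1}` (for `j < k`; no exclusion at the top level `j = k`; empty above `k`), with
`lamBondsSeq_subset_bondsOf_genSet` (print's datum ⊆ the (b)-datum: every INWARD CONNECTOR is dropped, nothing is added), its values at
`j = 0`, `0 < j < k`, `j = k`, `k < j`, and `AgreeOnB.lamBondsSeq_of_genSet` (agreement on the (b)-datum implies agreement on print's).  The
dictionary `b ∈ lamBondsSeq Ω k j ↔ (Node00.domainsOfSeq Ω k hk).LamBond j b` (under nesting and block saturation, the hypotheses of
`Node00/DomainsOfSeq` :219) is a `Node00/` statement (it needs `Node00/DomainsOfSeq`) and is NOT made here.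

READING (declared).  [Balaban1984PropagatorsII] p. 224 L10–16, verbatim: *"If Ω ⊂ T_η, then we denote by Ω also the set of bonds ⋃_{x∈Ω} st(x) =
{bonds b ⊂ T_η: at least one end-point of b belongs to Ω}. Let us define Λ_j = Ω_j^{(j)} ∖ Ω_{j+1}^{(j)}, j = 1, …, k − 1, Λ_k = Ω_k^{(k)}, Λ₀ =
Ω₁ᶜ (2.3) for the sets of sites and the sets of bonds"*.  Ruling of record (director-ym №339, (α)): `Λ_j` as a set of BONDS is the DIFFERENCE
`st(Ω_j^{(j)}) ∖ st(Ω_{j+1}^{(j)})` — an INWARD connector (one end-point in `Γ_j^{(j)}`, the other in `Ω_{j+1}^{(j)}`) belongs to no `Λ_j`,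
OUTWARD connectors (one end-point in `Γ_j^{(j)}`, the other outside `Ω_j^{(j)}`) belong to `Λ_j`; grounds: [Balaban1985RegularSpaces] (1.14)
p. 78 pins the gauge transformation at BOTH end-points of every constrained bond, and [Balaban1985Variational] (7) p. 278 L27–31 «it means that
y, z ∈ Λ_{j−1}».  «`y ∈ Ω_{j+1}^{(j)}`» is spelled `blockOf y ∈ pts (j+1) (Ω (j+1))`, exactly as `B6SectADomainsV1.Domains.Deep` :123
(`blockOf y ∈ D.Om (j+1)`) with `Om (j+1) := pts (j+1) (Ω (j+1))` as in `Node00/DomainsOfSeq`; UNDER block saturation of `Ω_{j+1}` this is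
«`y ∈ Ω_{j+1}`», and a non-deep end-point in `Ω_j^{(j)}` is then an end-point in `Γ_j^{(j)}` — whence the dictionary above.

Cell `pub-ymgap`, seat `pub-ymgap-node00-def-RR-2` gen 23 (DEFINER desk; `--kind definition --supports stmt-QuantumFields-20541`, helper,
count-neutral).  No `instance`, no `notation`, no `sorry`, no new axiom; K0⁷ stub 1 is NOT closed by this file; nothing of Bałaban's is
asserted; one finite four-torus programme at fixed `ε` — not ℝ⁴, not OS, not a mass gap.
-/

open Set

namespace Literature.MathematicalPhysics.QuantumFieldTheory.Balaban1983to89.B15DeterminingSetsB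

open B15DeterminingSets

variable {P : Params}

/-! ## §1  Bond-level determining data and [III] (2.10) over them -/

/-- A BOND-LEVEL determining datum: for every scale `j` a set of bonds of `T^{(j)}` — the bonds on which (2.10)'s `V = V_j` is imposed
([III] p. 256 *"The fields V_j determine the field V defined on 𝐁: V = V_j on Γ_j"*, with `Γ_j` read as a set of BONDS). [cite: Balaban1988Convergent, (2.10) p.256] -/
abbrev BDetSet (P : Params) : Type := (j : ℕ) → Set (PBond P j)

/-- The (b)-instance of a site-level determining set `𝔹 = {Γ_j}`: at each scale the bonds MEETING `Γ_j` (`B15DeterminingSets.bondsOf`,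
reading (b) of [I] p. 251 *"intervals … which intersect it"*). [cite: Balaban1987RG1, (0.1) p.251] -/
def bondsDet (𝔹 : DetSet P) : BDetSet P := fun j => bondsOf (𝔹 j)

/-- Unfolding of `bondsDet`. [cite: Balaban1987RG1, (0.1) p.251] -/
theorem bondsDet_apply (𝔹 : DetSet P) (j : ℕ) : bondsDet 𝔹 j = bondsOf (𝔹 j) := rfl

/-- `bondsDet` is monotone in the site sets. [cite: Balaban1987RG1, (0.1) p.251] -/
theorem bondsDet_mono {𝔹 𝔹' : DetSet P} (h : ∀ j, 𝔹 j ⊆ 𝔹' j) (j : ℕ) : bondsDet 𝔹 j ⊆ bondsDet 𝔹' j := by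
  intro b hb
  rcases hb with hs | ht
  · exact Or.inl (h j hs)
  · exact Or.inr (h j ht)

section Fields

variable {G : Type*}

/-- **[III] (2.10) over a bond-level datum**: two multi-scale fields define the same field on `𝔅` iff they agree on every bond of every
`𝔅_j`. [cite: Balaban1988Convergent, (2.10) p.256] -/
def AgreeOnB (𝔅 : BDetSet P) (V W : MSField P G) : Prop := ∀ j, ∀ b ∈ 𝔅 j, V j b = W j b

/-- The site-level (2.10) `B15DeterminingSets.AgreeOn 𝔹` IS `AgreeOnB` at the (b)-instance — definitionally. [cite: Balaban1988Convergent, (2.10) p.256] -/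
theorem agreeOnB_bondsDet (𝔹 : DetSet P) : (AgreeOnB (bondsDet 𝔹) : MSField P G → MSField P G → Prop) = AgreeOn 𝔹 := rfl

/-- Pointwise form of `agreeOnB_bondsDet`. [cite: Balaban1988Convergent, (2.10) p.256] -/
theorem agreeOn_iff_agreeOnB (𝔹 : DetSet P) (V W : MSField P G) : AgreeOn 𝔹 V W ↔ AgreeOnB (bondsDet 𝔹) V W := Iff.rfl

/-- (2.10) is ANTITONE in the datum: agreement on more bonds implies agreement on fewer. [cite: Balaban1988Convergent, (2.10) p.256] -/
theorem AgreeOnB.anti {𝔅 𝔅' : BDetSet P} (h : ∀ j, 𝔅' j ⊆ 𝔅 j) {V W : MSField P G} (hVW : AgreeOnB 𝔅 V W) :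
    AgreeOnB 𝔅' V W :=
  fun j b hb => hVW j b (h j hb)

/-- (2.10) is reflexive. [cite: Balaban1988Convergent, (2.10) p.256] -/
theorem AgreeOnB.refl (𝔅 : BDetSet P) (V : MSField P G) : AgreeOnB 𝔅 V V := fun _ _ _ => rfl

/-- (2.10) is symmetric. [cite: Balaban1988Convergent, (2.10) p.256] -/
theorem AgreeOnB.symm {𝔅 : BDetSet P} {V W : MSField P G} (h : AgreeOnB 𝔅 V W) : AgreeOnB 𝔅 W V :=
  fun j b hb => (h j b hb).symm

/-- (2.10) is transitive. [cite: Balaban1988Convergent, (2.10) p.256] -/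
theorem AgreeOnB.trans {𝔅 : BDetSet P} {V W X : MSField P G} (h₁ : AgreeOnB 𝔅 V W) (h₂ : AgreeOnB 𝔅 W X) :
    AgreeOnB 𝔅 V X :=
  fun j b hb => (h₁ j b hb).trans (h₂ j b hb)

/-! ## §2  The splice (1.20) of [IV] along a bond set -/

open Classical in
/-- Splicing two configurations of one scale along a BOND set `S`: the first on `S`, the second elsewhere (the restrictions `(W↾, V↾)` of
(1.20), (1.33) with the splice locus given bond-wise). [cite: Balaban1989LargeFieldI, (1.20) p.180] -/
noncomputable def spliceAtB {j : ℕ} (S : Set (PBond P j)) (W V : GaugeField P j G) : GaugeField P j G :=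
  fun b => if b ∈ S then W b else V b

/-- On a bond of `S` the splice is the first configuration. [cite: Balaban1989LargeFieldI, (1.20) p.180] -/
theorem spliceAtB_of_mem {j : ℕ} {S : Set (PBond P j)} (W V : GaugeField P j G) {b : PBond P j} (hb : b ∈ S) :
    spliceAtB S W V b = W b := by
  simp [spliceAtB, hb]

/-- Off `S` the splice is the second configuration. [cite: Balaban1989LargeFieldI, (1.20) p.180] -/
theorem spliceAtB_of_not_mem {j : ℕ} {S : Set (PBond P j)} (W V : GaugeField P j G) {b : PBond P j} (hb : b ∉ S) :
    spliceAtB S W V b = V b := by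
  simp [spliceAtB, hb]

/-- The site-level splice `B15DeterminingSets.spliceAt S` IS the bond-level splice along `bondsOf S`. [cite: Balaban1989LargeFieldI, (1.20) p.180] -/
theorem spliceAt_eq_spliceAtB {j : ℕ} (S : Set (Site P j)) (W V : GaugeField P j G) :
    spliceAt S W V = spliceAtB (bondsOf S) W V := by
  funext b
  by_cases hb : b ∈ bondsOf S
  · rw [spliceAtB_of_mem W V hb]
    simp [spliceAt, hb]
  · rw [spliceAtB_of_not_mem W V hb]
    simp [spliceAt, hb]

/-- Splicing along FEWER bonds changes nothing where the two configurations already agree: if `S' ⊆ S` and `W = V` on `S ∖ S'`, the two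
splices coincide. [cite: Balaban1989LargeFieldI, (1.20) p.180] -/
theorem spliceAtB_eq_of_subset {j : ℕ} {S S' : Set (PBond P j)} (hS : S' ⊆ S) (W V : GaugeField P j G)
    (hWV : ∀ b ∈ S, b ∉ S' → W b = V b) : spliceAtB S W V = spliceAtB S' W V := by
  funext b
  by_cases hb' : b ∈ S'
  · rw [spliceAtB_of_mem W V hb', spliceAtB_of_mem W V (hS hb')]
  · rw [spliceAtB_of_not_mem W V hb']
    by_cases hb : b ∈ S
    · rw [spliceAtB_of_mem W V hb, hWV b hb hb']
    · rw [spliceAtB_of_not_mem W V hb]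

variable [GaugeGroup G]

/-! ## §3  [III] (2.12) over a bond-level datum -/

/-- **[III] (2.12) over a bond-level datum**: `U₀` lies in the regular class `reg`, satisfies the averaging constraint on every bond of
`𝔅`, and minimizes the (`d = 4`) Wilson action among such configurations.  Existence ∕ uniqueness is [Balaban1985Variational] Thm 1, NOT
asserted. [cite: Balaban1988Convergent, (2.12) p.256] -/
def IsMinimizerB (av : ∀ j, Averaging P j G) (reg : Set (GaugeField P 0 G)) (𝔅 : BDetSet P) (V : MSField P G)
    (U₀ : GaugeField P 0 G) : Prop :=
  U₀ ∈ reg ∧ AgreeOnB 𝔅 (avgFamily av U₀) V ∧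
    ∀ U : GaugeField P 0 G, U ∈ reg → AgreeOnB 𝔅 (avgFamily av U) V → wilsonAction4 U₀ ≤ wilsonAction4 U

/-- The site-level (2.12) `B15DeterminingSets.IsMinimizer … 𝔹` IS `IsMinimizerB … (bondsDet 𝔹)` — definitionally. [cite: Balaban1988Convergent, (2.12) p.256] -/
theorem isMinimizer_iff_isMinimizerB (av : ∀ j, Averaging P j G) (reg : Set (GaugeField P 0 G)) (𝔹 : DetSet P) (V : MSField P G)
    (U₀ : GaugeField P 0 G) : IsMinimizer av reg 𝔹 V U₀ ↔ IsMinimizerB av reg (bondsDet 𝔹) V U₀ := Iff.rfl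

/-- A minimizer satisfies its constraint. [cite: Balaban1988Convergent, (2.12) p.256] -/
theorem IsMinimizerB.agreeOnB {av : ∀ j, Averaging P j G} {reg : Set (GaugeField P 0 G)} {𝔅 : BDetSet P} {V : MSField P G}
    {U₀ : GaugeField P 0 G} (h : IsMinimizerB av reg 𝔅 V U₀) : AgreeOnB 𝔅 (avgFamily av U₀) V := h.2.1

/-- A minimizer is regular. [cite: Balaban1988Convergent, (2.12) p.256] -/
theorem IsMinimizerB.mem_reg {av : ∀ j, Averaging P j G} {reg : Set (GaugeField P 0 G)} {𝔅 : BDetSet P} {V : MSField P G}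
    {U₀ : GaugeField P 0 G} (h : IsMinimizerB av reg 𝔅 V U₀) : U₀ ∈ reg := h.1

/-- A minimizer minimizes among the regular configurations with the same constraint. [cite: Balaban1988Convergent, (2.12) p.256] -/
theorem IsMinimizerB.le {av : ∀ j, Averaging P j G} {reg : Set (GaugeField P 0 G)} {𝔅 : BDetSet P} {V : MSField P G}
    {U₀ : GaugeField P 0 G} (h : IsMinimizerB av reg 𝔅 V U₀) {U : GaugeField P 0 G} (hU : U ∈ reg)
    (hUV : AgreeOnB 𝔅 (avgFamily av U) V) : wilsonAction4 U₀ ≤ wilsonAction4 U := h.2.2 U hU hUV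

/-- (2.12) depends on the data `V` only through its values on `𝔅`. [cite: Balaban1988Convergent, (2.12) p.256] -/
theorem isMinimizerB_congr_data {av : ∀ j, Averaging P j G} {reg : Set (GaugeField P 0 G)} {𝔅 : BDetSet P} {V V' : MSField P G}
    (hVV' : AgreeOnB 𝔅 V V') (U₀ : GaugeField P 0 G) : IsMinimizerB av reg 𝔅 V U₀ ↔ IsMinimizerB av reg 𝔅 V' U₀ := by
  have key : ∀ U : GaugeField P 0 G, AgreeOnB 𝔅 (avgFamily av U) V ↔ AgreeOnB 𝔅 (avgFamily av U) V' :=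
    fun U => ⟨fun h => h.trans hVV', fun h => h.trans hVV'.symm⟩
  simp only [IsMinimizerB, key]

/-- The solution map `(𝔅, V) ↦ U(𝔅, V)` of (2.12) over bond-level data, as DATA with its defining property on a domain `dom 𝔅` of regular
`V` — the bond-level twin of `B15DeterminingSets.DetBackground` ([III] (2.13), (2.15)). [cite: Balaban1988Convergent, (2.12)–(2.13) p.256–257] -/
structure DetBackgroundB (P : Params) (G : Type*) [GaugeGroup G] (av : ∀ j, Averaging P j G) where
  /-- the regular class -/
  reg : Set (GaugeField P 0 G)
  /-- the admissible data, per datum -/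
  dom : BDetSet P → Set (MSField P G)
  /-- the solution map -/
  U : BDetSet P → MSField P G → GaugeField P 0 G
  /-- its defining property (2.12) -/
  isMinimizer : ∀ 𝔅 V, V ∈ dom 𝔅 → IsMinimizerB av reg 𝔅 V (U 𝔅 V)

/-- PULL-BACK along `bondsDet`: a bond-level solution map restricts to a site-level one (`B15DeterminingSets.DetBackground`) on the
(b)-instances. [cite: Balaban1988Convergent, (2.12)–(2.13) p.256–257] -/
def DetBackgroundB.toDetBackground {av : ∀ j, Averaging P j G} (bg : DetBackgroundB P G av) : DetBackground P G av where
  reg := bg.reg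
  dom := fun 𝔹 => bg.dom (bondsDet 𝔹)
  U := fun 𝔹 V => bg.U (bondsDet 𝔹) V
  isMinimizer := fun 𝔹 V hV => (isMinimizer_iff_isMinimizerB av bg.reg 𝔹 V (bg.U (bondsDet 𝔹) V)).2 (bg.isMinimizer (bondsDet 𝔹) V hV)

/-- The pull-back's solution map, unfolded. [cite: Balaban1988Convergent, (2.12)–(2.13) p.256–257] -/
theorem DetBackgroundB.toDetBackground_U {av : ∀ j, Averaging P j G} (bg : DetBackgroundB P G av) (𝔹 : DetSet P) (V : MSField P G) :
    bg.toDetBackground.U 𝔹 V = bg.U (bondsDet 𝔹) V := rfl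

end Fields

/-! ## §4  PRINT's datum: [II] (2.3) `Λ_j` as the DIFFERENCE of the bond sets, over a (2.18) domain sequence `{Ω_j}` -/

/-- **[II] (2.3) AS A BOND-LEVEL DETERMINING DATUM** over a sequence `Ω : ℕ → Set T_η` with `k` levels: at level `j` the bonds of `T^{(j)}`
MEETING `Γ_j^{(j)}` (`bondsOf (genSet Ω k j)`; `Γ_j = Ω_j ∖ Ω_{j+1}`, `Γ₀ = Ω₁ᶜ`, `Γ_k = Ω_k`) none of whose two end-points `y` has its
`(j+1)`-block among the `(j+1)`-points of `Ω_{j+1}` («`y ∉ Ω_{j+1}^{(j)}`», the `Deep` of `B6SectADomainsV1` :123) — for `j < k`; at the top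
level there is nothing to exclude.  Verbatim p. 224: *"Λ_j = Ω_j^{(j)} ∖ Ω_{j+1}^{(j)} … (2.3) for the sets of sites and the sets of bonds"*
— the DIFFERENCE `st(Ω_j^{(j)}) ∖ st(Ω_{j+1}^{(j)})` (ruling (α) of record): inward connectors are NOT in `Λ_j`. [cite: Balaban1984PropagatorsII, (2.3) p.224] -/
def lamBondsSeq (Ω : ℕ → Set (Site P 0)) (k : ℕ) : BDetSet P := fun j =>
  {b | b ∈ bondsOf (genSet Ω k j) ∧
    (j < k → blockOf b.src ∉ pts (j + 1) (Ω (j + 1)) ∧ blockOf b.tgt ∉ pts (j + 1) (Ω (j + 1)))}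

section LamBonds

variable (Ω : ℕ → Set (Site P 0)) (k : ℕ)

/-- Unfolding of `lamBondsSeq`. [cite: Balaban1984PropagatorsII, (2.3) p.224] -/
theorem mem_lamBondsSeq_iff {j : ℕ} (b : PBond P j) :
    b ∈ lamBondsSeq Ω k j ↔ b ∈ bondsOf (genSet Ω k j) ∧
      (j < k → blockOf b.src ∉ pts (j + 1) (Ω (j + 1)) ∧ blockOf b.tgt ∉ pts (j + 1) (Ω (j + 1))) :=
  Iff.rfl

/-- **PRINT's DATUM ⊆ THE (b)-DATUM**: every bond of `Λ_j` meets `Γ_j^{(j)}`; the difference consists exactly of the INWARD CONNECTORS, which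
print's `Λ_j` omits and `bondsOf (genSet …)` keeps. [cite: Balaban1984PropagatorsII, (2.3) p.224] -/
theorem lamBondsSeq_subset_bondsOf_genSet (j : ℕ) : lamBondsSeq Ω k j ⊆ bondsOf (genSet Ω k j) := fun _ hb => hb.1

/-- The same inclusion, in `bondsDet` form. [cite: Balaban1984PropagatorsII, (2.3) p.224] -/
theorem lamBondsSeq_subset_bondsDet (j : ℕ) : lamBondsSeq Ω k j ⊆ bondsDet (genSet Ω k) j :=
  lamBondsSeq_subset_bondsOf_genSet Ω k j

/-- An INWARD CONNECTOR (an end-point deep in `Ω_{j+1}`, `j < k`) is not a bond of `Λ_j`. [cite: Balaban1984PropagatorsII, (2.3) p.224] -/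
theorem not_mem_lamBondsSeq_of_deep {j : ℕ} (hjk : j < k) {b : PBond P j}
    (hb : blockOf b.src ∈ pts (j + 1) (Ω (j + 1)) ∨ blockOf b.tgt ∈ pts (j + 1) (Ω (j + 1))) : b ∉ lamBondsSeq Ω k j := by
  intro h
  rcases hb with hs | ht
  · exact (h.2 hjk).1 hs
  · exact (h.2 hjk).2 ht

/-- At and above the top level there is no exclusion: `Λ_j`'s bonds are all the bonds meeting `Γ_j^{(j)}`. [cite: Balaban1984PropagatorsII, (2.3) p.224] -/
theorem lamBondsSeq_of_le {j : ℕ} (hkj : k ≤ j) : lamBondsSeq Ω k j = bondsOf (genSet Ω k j) := by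
  ext b
  rw [mem_lamBondsSeq_iff]
  constructor
  · exact fun h => h.1
  · exact fun h => ⟨h, fun hjk => absurd hjk (not_lt.2 hkj)⟩

/-- **TOP LEVEL** `Λ_k = Ω_k^{(k)}` (sites and bonds): the bonds meeting `Ω_k^{(k)}`. [cite: Balaban1984PropagatorsII, (2.3) p.224] -/
theorem lamBondsSeq_top : lamBondsSeq Ω k k = bondsOf (pts k (Ω k)) := by
  rw [lamBondsSeq_of_le Ω k le_rfl]
  show bondsOf (pts k (gammaRegion Ω k k)) = _
  rw [gammaRegion_self]

/-- Above the top level the datum is EMPTY (there is no `Γ_j` for `j > k`). [cite: Balaban1984PropagatorsII, (2.3) p.224] -/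
theorem lamBondsSeq_of_gt {j : ℕ} (hkj : k < j) : lamBondsSeq Ω k j = ∅ := by
  rw [lamBondsSeq_of_le Ω k hkj.le]
  ext b
  simp [bondsOf, genSet, gammaRegion_of_gt Ω hkj, pts]

/-- **MIDDLE LEVELS** `0 < j < k`: a bond of `Λ_j` has an end-point in `(Ω_j ∖ Ω_{j+1})^{(j)}` and NO end-point deep in `Ω_{j+1}`.
[cite: Balaban1984PropagatorsII, (2.3) p.224] -/
theorem mem_lamBondsSeq_iff_of_mid {j : ℕ} (h0 : 0 < j) (hjk : j < k) (b : PBond P j) :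
    b ∈ lamBondsSeq Ω k j ↔
      (b.src ∈ pts j (Ω j \ Ω (j + 1)) ∨ b.tgt ∈ pts j (Ω j \ Ω (j + 1))) ∧
        blockOf b.src ∉ pts (j + 1) (Ω (j + 1)) ∧ blockOf b.tgt ∉ pts (j + 1) (Ω (j + 1)) := by
  rw [mem_lamBondsSeq_iff]
  simp only [bondsOf, genSet, gammaRegion_mid Ω h0 hjk, Set.mem_setOf_eq, hjk, forall_true_left]

/-- **LEVEL ZERO** (`0 < k`): `Λ₀ = Ω₁ᶜ` — a bond of `Λ₀` has an end-point outside `Ω₁` and NO end-point deep in `Ω₁`.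
[cite: Balaban1984PropagatorsII, (2.3) p.224] -/
theorem mem_lamBondsSeq_iff_zero (hk : 0 < k) (b : PBond P 0) :
    b ∈ lamBondsSeq Ω k 0 ↔
      (b.src ∈ (Ω 1)ᶜ ∨ b.tgt ∈ (Ω 1)ᶜ) ∧ blockOf b.src ∉ pts 1 (Ω 1) ∧ blockOf b.tgt ∉ pts 1 (Ω 1) := by
  rw [mem_lamBondsSeq_iff]
  simp only [bondsOf, genSet, gammaRegion_zero Ω hk, pts_zero, Set.mem_setOf_eq, hk, forall_true_left]

/-- print's datum is MONOTONE-FREE in no variable but inherits emptiness: if `Γ_j^{(j)}` meets no bond, `Λ_j` has no bonds.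
[cite: Balaban1984PropagatorsII, (2.3) p.224] -/
theorem lamBondsSeq_eq_empty_of_genSet {j : ℕ} (h : genSet Ω k j = ∅) : lamBondsSeq Ω k j = ∅ := by
  ext b
  simp [mem_lamBondsSeq_iff, bondsOf, h]

end LamBonds

section Agreement

variable {G : Type*} {Ω : ℕ → Set (Site P 0)} {k : ℕ}

/-- Agreement on the (b)-datum `genSet Ω k` (every bond meeting every `Γ_j`) implies agreement on PRINT's datum (fewer bonds).
[cite: Balaban1988Convergent, (2.10) p.256] -/
theorem AgreeOnB.lamBondsSeq_of_genSet {V W : MSField P G} (h : AgreeOn (genSet Ω k) V W) : AgreeOnB (lamBondsSeq Ω k) V W :=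
  AgreeOnB.anti (lamBondsSeq_subset_bondsOf_genSet Ω k) ((agreeOn_iff_agreeOnB (genSet Ω k) V W).1 h)

variable [GaugeGroup G]

/-- A configuration satisfying the (b)-constraint satisfies PRINT's constraint (the converse fails in general: print constrains fewer
bonds, so its minimizer is a priori a DIFFERENT configuration — the content of FLAG №16). [cite: Balaban1988Convergent, (2.12) p.256] -/
theorem agreeOnB_lamBondsSeq_avgFamily_of_agreeOn {av : ∀ j, Averaging P j G} {U : GaugeField P 0 G} {V : MSField P G}
    (h : AgreeOn (genSet Ω k) (avgFamily av U) V) : AgreeOnB (lamBondsSeq Ω k) (avgFamily av U) V :=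
  AgreeOnB.lamBondsSeq_of_genSet h

end Agreement

end Literature.MathematicalPhysics.QuantumFieldTheory.Balaban1983to89.B15DeterminingSetsB
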